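import Summits.BirchSwinnertonDyer.BirchSwinnertonDyer.Theorems.ByReductionTypeAtTwoRankOneAtTwoBigImageOddLocalOneDoorGlue
import Literature.NumberTheory.EllipticCurves.NonvanishingTwistsWaldspurgerOfHoffsteinLuo
import Literature.NumberTheory.EllipticCurves.NonvanishingTwistsProofs
import Literature.NumberTheory.EllipticCurves.BSDRootNumberModularityOnlyProofs
import HarnessLib

/-!
# Route ByReductionTypeAtTwo, crux `RankOneAtTwoBigImageOddLocal` (stmt-BirchSwinnertonDyer-23715), line v8 `one_door_analytic`:
# the NON-VANISHING DOOR SUPPLY `exists_doorField_of_hoffsteinLuo` as a tree theorem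

Width seat `bsd-line-fkl-p2` g6 (2026-08-28), at the lead's request (bus 08:20:32Z: "proposed free kernel target (v8-ready):
`exists_doorField_of_hoffsteinLuo`").  The PROOF is the planner `bsd-f1-sign2-an` g11's `doorSupplyAnalyticAtTwo_of_pubHL`
(§1 of the crux skeleton `Cruxes/RankOneAtTwoBigImageOddLocal/Lines/one_door_analytic.lean`, kernel-checked there), transported
VERBATIM into `Theorems/` so that the v8 supply can be cited BY NAME (skeleton files are not importable; planners do not write
under `Theorems/`):

* `exists_doorField_of_rootNumber_eq_neg_one` — for `W/ℚ` globally minimal elliptic with `w(W) = −1`, modulo the tree's named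
  facts `exists_isNewformOf` (BCDT 2001 Thm. A) and `HoffsteinLuo1997_exists_twist_L_one_ne_zero` (Hoffstein–Luo 1997, Theorem):
  there is an imaginary quadratic `K` with `d_K` DOOR-ADMISSIBLE (`d_K < 0` square-free, `d_K ≡ 1 (mod 8)`, every `q ∣ d_K` good,
  `(d_K/ℓ) = 1` at the odd bad `ℓ`), `L(W^{(d_K)},1) ≠ 0`, `(d_K, N) = 1` and the Heegner hypothesis for `N = N_W`.
  Steps (all -an's): Hoffstein–Luo with the bad primes adjoined gives a square-free `d ≡ 1 (8)`, `(d/ℓ) = 1` at odd `ℓ ∣ N`,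
  `L(W^{(d)},1) ≠ 0`, and `d < 0` is FORCED by the sign of the twist (`exists_neg_fundamental_twist_ne_zero_of_hoffsteinLuo`);
  no prime of `N` divides `d` (`(d/ℓ) = 1`, resp. `d` odd), so every prime of `d` is good; `K = ℚ(√d)` with `d_K = d` and the
  Heegner hypothesis (`exists_heegnerField_iff_exists_fundamental`).
* `exists_doorField_of_analyticRank_eq_one` — the same from `r_an(W) = 1` (`w = −1` by modularity,
  `even_analyticRank_iff_rootNumber_eq_one_of_exists_isNewformOf`).
* `doorSupplyAnalyticAtTwo_of_hoffsteinLuo` — v8's `DoorSupplyAnalyticAtTwo` body VERBATIM from the two named facts, so that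
  `stub`/theorem `doorSupplyAnalyticAtTwo_of_pubHL` of the skeleton is `fun ⟨hmod, hHL⟩ => doorSupplyAnalyticAtTwo_of_hoffsteinLuo hmod hHL`.

BSD is not proved by any of this; the two named facts are PRINT and undischarged in the tree (conditional results).
-/

set_option autoImplicit false
set_option linter.dupNamespace false

noncomputable section

open scoped Classical

namespace Summit.BirchSwinnertonDyer.BirchSwinnertonDyer.Theorems.RankOneAtTwoOneDoor

open WeierstrassCurve NumberField IsDedekindDomain Literature.NumberTheory.EllipticCurves
  Literature.NumberTheory.EllipticCurves.ModularForms
  Summit.BirchSwinnertonDyer.Rank1Residual.F1Sign2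
  Summit.BirchSwinnertonDyer.Rank1Residual.F1Sign2.TranspositionDoor
  Summit.BirchSwinnertonDyer.Rank1Residual

/-- A prime not dividing the conductor is a prime of good reduction (light derivation through the conductor exponent, as in
the skeleton: `factorization_conductorNorm`, `conductorExponent_eq_zero_iff`; Silverman *ATAEC* IV.10.2(a)). [folklore] -/
private theorem hasGoodReductionAtPrime_of_not_dvd_conductorNorm_aux (W : WeierstrassCurve ℚ) [W.IsElliptic]
    {ℓ : ℕ} [hℓ : Fact ℓ.Prime] (h : ¬ ℓ ∣ W.conductorNorm ℤ) : W.HasGoodReductionAtPrime ℓ := by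
  set v : HeightOneSpectrum ℤ := (Rat.HeightOneSpectrum.primesEquiv (R := ℤ)).symm ⟨ℓ, hℓ.out⟩ with hv
  have hgen : Rat.HeightOneSpectrum.natGenerator v = ℓ :=
    congrArg Subtype.val ((Rat.HeightOneSpectrum.primesEquiv (R := ℤ)).apply_symm_apply ⟨ℓ, hℓ.out⟩)
  have hfac : (W.conductorNorm ℤ).factorization ℓ = 0 := Nat.factorization_eq_zero_of_not_dvd h
  have hf : W.conductorExponent v = 0 := by
    rw [← W.factorization_conductorNorm_holds v, hgen, hfac]
  have hgood' : W.HasGoodReductionAt v :=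
    (WeierstrassCurve.conductorExponent_eq_zero_iff_holds v W).mp hf
  exact (W.hasGoodReductionAtPrime_iff_hasGoodReductionAt_holds ⟨ℓ, hℓ.out⟩).mpr hgood'

/-- **The non-vanishing DOOR supply (Waldspurger–Hoffstein–Luo), from `w(W) = −1`.**  For `W/ℚ` globally minimal elliptic
with root number `−1`, modulo `exists_isNewformOf` and `HoffsteinLuo1997_exists_twist_L_one_ne_zero`: an imaginary quadratic
`K` with `d_K` door-admissible, `L(W^{(d_K)},1) ≠ 0`, `(d_K, N_W) = 1` and the Heegner hypothesis for `N_W`.  Proof =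
planner -an g11's `doorSupplyAnalyticAtTwo_of_pubHL` (skeleton `one_door_analytic.lean` §1), verbatim.
[cite: HoffsteinLuo1997, Theorem (§1, pp. 435–436)] [cite: MurtyMurty1997, Ch. 6 §1, p. 96] -/
theorem exists_doorField_of_rootNumber_eq_neg_one (hmod : exists_isNewformOf)
    (hHL : HoffsteinLuo1997_exists_twist_L_one_ne_zero)
    (W : WeierstrassCurve ℚ) [W.IsElliptic] [W.IsGloballyMinimal] (hw : W.rootNumber = -1) :
    ∃ (K : Type) (_ : Field K) (_ : NumberField K),
      IsImaginaryQuadratic K ∧ DoorAdmissible W (NumberField.discr K) ∧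
      (W.quadraticTwist (NumberField.discr K : ℚ)).entireLFunction 1 ≠ 0 ∧
      Nat.Coprime (NumberField.discr K).natAbs (W.conductorNorm ℤ) ∧
      SatisfiesHeegnerHypothesis (W.conductorNorm ℤ) K := by
  set N : ℕ := W.conductorNorm ℤ with hN_def
  have hN0 : N ≠ 0 := (W.conductorNorm_pos_holds).ne'
  -- Hoffstein–Luo's negative square-free `d ≡ 1 (8)` with `(d/ℓ) = 1` at the odd bad primes and `L(W^{(d)}, 1) ≠ 0`
  obtain ⟨d, hdneg, hsq, hd8, -, -, hjacN, hL⟩ :=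
    exists_neg_fundamental_twist_ne_zero_of_hoffsteinLuo hmod hHL W hw ∅ 0
  have hd0 : d ≠ 0 := hdneg.ne
  -- no prime of `N` divides `d`
  have hndvd : ∀ p : ℕ, p.Prime → p ∣ N → ¬ (p : ℤ) ∣ d := by
    intro p hp hpN hpd
    by_cases hp2 : p = 2
    · subst hp2
      have : d % 2 = 0 := Int.emod_eq_zero_of_dvd (by exact_mod_cast hpd)
      omega
    · have hj : jacobiSym d p = 1 := hjacN p hp hpN hp2
      rw [jacobiSym.mod_left, Int.emod_eq_zero_of_dvd hpd, jacobiSym.zero_left hp.one_lt] at hj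
      exact zero_ne_one hj
  -- the field `K = ℚ(√d)`
  obtain ⟨K, _iF, _iN, hK, -, hHN, hdK⟩ :=
    (exists_heegnerField_iff_exists_fundamental N 0 (fun D => D = d)).mpr
      ⟨d, hdneg, Or.inl ⟨by omega, hsq, by omega⟩, by simpa using Int.natAbs_pos.mpr hd0 |>.ne',
        fun p hp hpN => ⟨fun _ => hd8, fun hp2 => hjacN p hp hpN hp2⟩, rfl⟩
  refine ⟨K, _iF, _iN, hK, ?_, ?_, ?_, hHN⟩
  · -- door-admissible
    rw [hdK]
    refine ⟨hdneg, hsq, hd8, ?_, ?_⟩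
    · intro q hq hqd _hF
      have hqN : ¬ q ∣ N := fun hqN => hndvd q hq hqN hqd
      exact hasGoodReductionAtPrime_of_not_dvd_conductorNorm_aux W hqN
    · intro ℓ hℓ hℓ2 hbad
      by_cases hℓN : ℓ ∣ N
      · exact hjacN ℓ hℓ hℓN hℓ2
      · exact absurd (hasGoodReductionAtPrime_of_not_dvd_conductorNorm_aux W (hℓ := ⟨hℓ⟩) hℓN) (hbad ⟨hℓ⟩)
  · -- `L(W^{(d_K)}, 1) ≠ 0`
    rw [hdK]; exact hL
  · -- `(d_K, N) = 1`
    rw [hdK]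
    exact Nat.coprime_of_dvd fun p hp hpd hpN => hndvd p hp hpN (Int.ofNat_dvd_left.mpr hpd)

/-- **The non-vanishing door supply from analytic rank one**: `r_an(W) = 1` gives `w(W) = −1` by modularity
(`even_analyticRank_iff_rootNumber_eq_one_of_exists_isNewformOf`), then `exists_doorField_of_rootNumber_eq_neg_one`.
[cite: HoffsteinLuo1997, Theorem (§1, pp. 435–436)] -/
theorem exists_doorField_of_analyticRank_eq_one (hmod : exists_isNewformOf)
    (hHL : HoffsteinLuo1997_exists_twist_L_one_ne_zero)
    (W : WeierstrassCurve ℚ) [W.IsElliptic] [W.IsGloballyMinimal] (hr : W.analyticRank = 1) :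
    ∃ (K : Type) (_ : Field K) (_ : NumberField K),
      IsImaginaryQuadratic K ∧ DoorAdmissible W (NumberField.discr K) ∧
      (W.quadraticTwist (NumberField.discr K : ℚ)).entireLFunction 1 ≠ 0 ∧
      Nat.Coprime (NumberField.discr K).natAbs (W.conductorNorm ℤ) ∧
      SatisfiesHeegnerHypothesis (W.conductorNorm ℤ) K := by
  have hw : W.rootNumber = -1 := by
    have hiff : Even W.analyticRank ↔ W.rootNumber = 1 :=
      even_analyticRank_iff_rootNumber_eq_one_of_exists_isNewformOf W hmod
    rcases rootNumber_eq_one_or_eq_neg_one W with h1 | h1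
    · exfalso
      have hev : Even W.analyticRank := hiff.mpr h1
      rw [hr] at hev
      exact Nat.not_even_one hev
    · exact h1
  exact exists_doorField_of_rootNumber_eq_neg_one hmod hHL W hw

/-- **v8's `DoorSupplyAnalyticAtTwo` (body verbatim) from the two named facts** — so that the skeleton's
`doorSupplyAnalyticAtTwo_of_pubHL : S_pubHL → DoorSupplyAnalyticAtTwo` is `fun h => doorSupplyAnalyticAtTwo_of_hoffsteinLuo h.1 h.2`.
[cite: HoffsteinLuo1997, Theorem (§1, pp. 435–436)] -/
theorem doorSupplyAnalyticAtTwo_of_hoffsteinLuo (hmod : exists_isNewformOf)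
    (hHL : HoffsteinLuo1997_exists_twist_L_one_ne_zero) :
    ∀ (W : WeierstrassCurve ℚ) [W.IsElliptic] [W.IsGloballyMinimal] [NeZero (W.conductorNorm ℤ)],
      W.analyticRank = 1 →
      ∃ (K : Type) (_ : Field K) (_ : NumberField K),
        IsImaginaryQuadratic K ∧ DoorAdmissible W (NumberField.discr K) ∧
        (W.quadraticTwist (NumberField.discr K : ℚ)).entireLFunction 1 ≠ 0 ∧
        Nat.Coprime (NumberField.discr K).natAbs (W.conductorNorm ℤ) ∧
        SatisfiesHeegnerHypothesis (W.conductorNorm ℤ) K :=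
  fun W _ _ _ hr => exists_doorField_of_analyticRank_eq_one hmod hHL W hr

end Summit.BirchSwinnertonDyer.BirchSwinnertonDyer.Theorems.RankOneAtTwoOneDoor

end
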